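import Summits.ValiantsHypothesis.ValiantsHypothesis.Theses.ShallowShadows
import Literature.Computability.Complexity.FormulaComposition

/-!
# Crux `RazWigdersonMatching` (stmt-ValiantsHypothesis-17127): load-bearing threshold and non-vacuity

Refuter crux-attack record (route `ShallowShadows`). The crux
`∃ c > 0, ∃ m₀, ∀ m ≥ m₀, 2 ^ (c·m) ≤ formulaSizeOver monotoneBasis (perfectMatchingFn m)` is the
published Raz–Wigderson theorem (J. ACM 39 (1992), Thm. 4.2: monotone depth `Ω(n)` for bipartite
perfect matching, combined with monotone formula balancing, Jukna 2012 Lemma 6.1 / Cor. 7.27) and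
is literally the Literature named fact `RazWigderson1992_bpm_monotoneFormulaSize`; no refutation
is possible. What the tree's straight-line model (`Literature.Computability.Complexity.Circuit`,
`formulaSizeOver` = an `sInf` over `ℕ` with junk value `0`) lets us CHECK cheaply:

* `formulaSizeOver_perfectMatchingFn_one` — `PM_1 = x₀₀` is computed by the gate-free input
  circuit, so its monotone formula complexity is genuinely `0`; hence
  `razWigdersonMatching_false_without_threshold`: the crux with `∀ m` in place of `∀ m ≥ m₀` is
  FALSE — the threshold `m₀` is load-bearing and every proof must take `m₀ ≥ 2`.
* `exists_monotoneFormula_perfectMatchingFn` — for every `m ≥ 1` the monotone DNF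
  `⋁_σ ⋀ᵢ x_{i,σ i}` is a `{∧₂, ∨₂}`-formula computing `perfectMatchingFn m`; so
  (`exists_minimal_monotoneFormula_perfectMatchingFn`) the infimum defining
  `formulaSizeOver monotoneBasis (perfectMatchingFn m)` is ATTAINED by a genuine monotone formula:
  the crux is a statement about real formulas, not junk-false. (This is the birth skeleton's stub
  `stub_formulaExists` = `BPMMonotoneFormulaExists`, verbatim.)
-/

namespace Summit.ValiantsHypothesis.ValiantsHypothesis.Theorems.RazWigdersonMatching.Negative

-- summit = sub-problem name (single-conjunct summit, D-0017 layout), so the namespace repeats it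
set_option linter.dupNamespace false

open Literature.Computability.Complexity Literature.Computability.Complexity.Circuit
open Literature.Barriers.PneNP

/-- On `K_{1,1}` the perfect matching function is the single edge variable `x (0,0)`. [folklore] -/
theorem perfectMatchingFn_one (x : Fin 1 × Fin 1 → Bool) : perfectMatchingFn 1 x = x (0, 0) := by
  rw [Bool.eq_iff_iff, perfectMatchingFn_eq_true_iff]
  constructor
  · rintro ⟨σ, hσ⟩
    have h := hσ 0
    rwa [Subsingleton.elim (σ 0) 0] at h
  · intro h
    refine ⟨1, fun i => ?_⟩
    fin_cases i
    simpa using h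

/-- The gate-free input circuit `x ↦ x (0,0)` computes `PM_1`. [folklore] -/
theorem input_computes_perfectMatchingFn_one :
    (input ((0 : Fin 1), (0 : Fin 1))).Computes (perfectMatchingFn 1) := fun x => by
  rw [eval_input, perfectMatchingFn_one]

/-- `PM_1` has monotone formula complexity `0` GENUINELY (not as a junk value): the input circuit
has no gates. [folklore] -/
theorem formulaSizeOver_perfectMatchingFn_one :
    formulaSizeOver monotoneBasis (perfectMatchingFn 1) = 0 := by
  apply Nat.eq_zero_of_le_zero
  simpa using formulaSizeOver_le_of_computes (input ((0 : Fin 1), (0 : Fin 1)))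
    (isOver_input monotoneBasis _) (isFormula_input _).1 input_computes_perfectMatchingFn_one

/-- **Load-bearing threshold.** The crux `RazWigdersonMatching` with the threshold `m₀` dropped
(`∀ m` instead of `∀ m ≥ m₀`) is false: at `m = 1` the right-hand side is `0 < 2 ^ c`. So any
proof of the crux must use `m₀ ≥ 2`. [folklore] -/
theorem razWigdersonMatching_false_without_threshold :
    ¬ ∃ c : ℝ, 0 < c ∧ ∀ m : ℕ,
      (2 : ℝ) ^ (c * m) ≤ formulaSizeOver monotoneBasis (perfectMatchingFn m) := by
  rintro ⟨c, -, h⟩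
  have h1 : (2 : ℝ) ^ (c * ((1 : ℕ) : ℝ)) ≤
      (formulaSizeOver monotoneBasis (perfectMatchingFn 1) : ℝ) := h 1
  rw [formulaSizeOver_perfectMatchingFn_one, Nat.cast_zero] at h1
  exact absurd h1 (not_le.mpr (Real.rpow_pos_of_pos two_pos _))

/-- **Non-vacuity.** For `m ≥ 1` the monotone DNF `⋁_{σ ∈ S_m} ⋀_{i < m} x_{i, σ i}` is a
`{∧₂, ∨₂}`-formula computing `perfectMatchingFn m` (the birth skeleton's `stub_formulaExists`,
verbatim). [folklore; Jukna 2012 §1.1] -/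
theorem exists_monotoneFormula_perfectMatchingFn (m : ℕ) (hm : 1 ≤ m) :
    ∃ F : Circuit (Fin m × Fin m),
      F.IsOver monotoneBasis ∧ F.IsFormula ∧ F.Computes (perfectMatchingFn m) := by
  obtain ⟨k, rfl⟩ : ∃ k, m = k + 1 := ⟨m - 1, by omega⟩
  obtain ⟨M, hM⟩ : ∃ M, Fintype.card (Equiv.Perm (Fin (k + 1))) = M + 1 :=
    ⟨Fintype.card (Equiv.Perm (Fin (k + 1))) - 1, by
      have := Fintype.card_pos (α := Equiv.Perm (Fin (k + 1)))
      omega⟩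
  obtain ⟨e⟩ : Nonempty (Equiv.Perm (Fin (k + 1)) ≃ Fin (M + 1)) :=
    ⟨(Fintype.equivFin _).trans (finCongr hM)⟩
  refine ⟨bigOr M fun j => bigAnd k fun i => input (i, e.symm j i), ?_, ?_, ?_⟩
  · exact isOver_bigOr or_two_mem_monotoneBasis M _ fun j =>
      isOver_bigAnd and_two_mem_monotoneBasis k _ fun i => isOver_input _ _
  · exact (isFormula_bigOr M _ fun j => isFormula_bigAnd k _ fun i => isFormula_input _).1
  · intro x
    have hterm : ∀ σ : Equiv.Perm (Fin (k + 1)),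
        (bigAnd k fun i => input (i, σ i)).eval x = true ↔ ∀ i, x (i, σ i) = true := by
      intro σ
      simp only [eval_bigAnd, eval_input, decide_eq_true_eq]
    rw [eval_bigOr]
    unfold perfectMatchingFn
    refine decide_eq_decide.mpr ⟨?_, ?_⟩
    · rintro ⟨j, hj⟩
      exact ⟨e.symm j, (hterm _).mp hj⟩
    · rintro ⟨σ, hσ⟩
      refine ⟨e σ, ?_⟩
      rw [Equiv.symm_apply_apply]
      exact (hterm σ).mpr hσ

/-- For `m ≥ 1` the infimum defining `formulaSizeOver monotoneBasis (perfectMatchingFn m)` is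
attained by a genuine monotone formula (so the crux quantifies over real formulas). [folklore] -/
theorem exists_minimal_monotoneFormula_perfectMatchingFn (m : ℕ) (hm : 1 ≤ m) :
    ∃ F : Circuit (Fin m × Fin m), F.IsOver monotoneBasis ∧ F.IsFormula ∧
      F.Computes (perfectMatchingFn m) ∧
        F.size = formulaSizeOver monotoneBasis (perfectMatchingFn m) := by
  have hne : {s | ∃ C : Circuit (Fin m × Fin m), C.IsOver monotoneBasis ∧ C.IsFormula ∧
      C.Computes (perfectMatchingFn m) ∧ C.size = s}.Nonempty := by
    obtain ⟨F, h₁, h₂, h₃⟩ := exists_monotoneFormula_perfectMatchingFn m hm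
    exact ⟨F.size, F, h₁, h₂, h₃, rfl⟩
  obtain ⟨F, h₁, h₂, h₃, h₄⟩ := Nat.sInf_mem hne
  exact ⟨F, h₁, h₂, h₃, h₄⟩

end Summit.ValiantsHypothesis.ValiantsHypothesis.Theorems.RazWigdersonMatching.Negative
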